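import Mathlib
import HarnessLib
import Summits.Ventures.LatticeQCDFlow.Scaling.AutoregressiveSiteProposalAcceptance
import Summits.Ventures.LatticeQCDFlow.Scaling.AutoregressiveGaugeAcceptanceCeiling
import Literature.Barriers.QuantumFields.CenterSymmetryBreakingByQuarks
import Summits.Ventures.LatticeQCDFlow.TrivializingMaps.WilsonMeasureTrivializingMap

/-!
# LatticeQCDFlow / Scaling — A VOLUME-UNIFORM CEILING FOR LEARNED HEAT BATHS: a Metropolised single-link
# update whose proposal ignores the links at one endpoint of the link accepts in equilibrium at most
# `1 − ⟨(1/N) Re tr U_p⟩_β / 2` — every compact gauge group with a central scalar, every d, L, β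

HONEST FRAMING: exact (Metropolis-corrected) sampling algorithms for lattice gauge theory;
figures of merit are autocorrelation/cost numbers at stated couplings and volumes; no
continuum-physics claim.

Venture `LatticeQCDFlow` (cell pub-lqcd), topic `Scaling`, FANOUT row 30 (lean-1, GEN-19) — OUR WORK, the
local analogue of `Scaling/AutoregressiveGaugeAcceptanceCeiling` (whole-configuration proposals:
`ā ≤ 1 − ⟨W₁ₓ₁⟩/4`): `Scaling/AutoregressiveSiteProposalAcceptance` (`ā_a ≤ 1 − (1/(2Z))∫|F − q·A_aF|`),
`Scaling/AutoregressiveGaugeVertexBlindProposal` (vertex-blind `q` is no better than flat),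
`Scaling/AutoregressiveGaugeAcceptanceCeiling` (`integral_abs_condGap_mono`: less context, closer to
flat) and `Scaling/AutoregressiveGaugePlaquetteMarginal` (the flat law is far from the one-staple
conditional: `∫Re tr ρ(U_p)F ≤ N∫|A_sF − A_{insert a s}F|`).

## What is proved

**`wilson_siteMeanAccept_le_of_vertexBlind`** [ours] — Wilson weight `F = e^{−βS_W}` (continuous `ρ`,
central element acting by `ω ≠ 1`, `L ≥ 2`, any `β`), plaquette `p = (x; k, l)`, its link `a = (x, k)`, a
bounded measurable proposal density `q ≥ 0` for `U_a`, normalised in `a`, reading EVERY link except those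
at one endpoint `y` of `a`: the equilibrium acceptance of the Metropolised update of `a` with proposal `q`
satisfies `ā_a ≤ 1 − (1/(2NZ))∫Re tr ρ(U_p)·F dπ = 1 − ½⟨(1/N)Re tr U_p⟩_β`;
**`wilson_siteMeanAccept_le_linkBall`** — unitary `ρ`, `N ≥ 1`, `d ≥ 2`, `β > 0`, every `r > 0`:
`ā_a ≤ 1 − ½(1 − 8r²/N + 2 log φ_ρ(r)/((d−1)Nβ))`, uniformly in `L`, tending to `1/2` as `β → ∞`;
**`sun_siteMeanAccept_le_linkBall`** (`SU(n)`, `n ≥ 2`, defining representation, centre `e^{2πi/n}·1`) and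
**`u1_siteMeanAccept_le_linkBall`** (`U(1)`, `u1Rep`, centre `−1`): the instances.

READING (value-free): a learned one-link sampler — the building block of an exact "neural heat bath" for
`SU(3)` — must read the links at BOTH endpoints of the link it updates; one missing endpoint costs at least
half the mean plaquette in acceptance, at every volume.  NOT CLAIMED: conditioners reading both endpoints;
autocorrelations of the sweep.  Elementary over the parents; no `def`, no `sorry`, nothing cited as a fact.
-/

noncomputable section

namespace Summit.Ventures.LatticeQCDFlow.Theory2.Autoregressive

open MeasureTheory Function Set
open Literature.MathematicalPhysics.QuantumFieldTheory Literature.MathematicalPhysics.QuantumLattice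
open Summit.Ventures.LatticeQCDFlow.Exactness
open Summit.Ventures.LatticeQCDFlow.TrivializingMaps (StrongCoupling.defRep)
open scoped Matrix Matrix.Norms.Frobenius

variable {d L N : ℕ} {G : Type*} [Group G] [TopologicalSpace G] [IsTopologicalGroup G]
  [CompactSpace G] [SecondCountableTopology G] [MeasurableSpace G] [BorelSpace G] [NeZero L]
  (ρ : G →* Matrix (Fin N) (Fin N) ℂ)

set_option maxHeartbeats 400000 in
/-- **LEARNED HEAT BATH, VERTEX-BLIND PROPOSAL: `ā_a ≤ 1 − ½⟨(1/N)Re tr U_p⟩_β`.** [ours] -/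
theorem wilson_siteMeanAccept_le_of_vertexBlind (hρ : Continuous ρ) (hL : 2 ≤ L)
    {z : G} {ω : ℂ} (hω : ρ z = ω • (1 : Matrix (Fin N) (Fin N) ℂ)) (hne : ω ≠ 1) (β : ℝ)
    (p : Plaquette d L)
    {q : GaugeConfig d L G → ℝ} (hqm : Measurable q) (hq0 : ∀ U, 0 ≤ q U) {Cq : ℝ} (hqb : ∀ U, q U ≤ Cq)
    (hq1 : ∀ U, ∫ v, q (update U (p.1, p.2.1.1) v) ∂(haarProbability G) = 1)
    {y : Site d L} (hy : p.1 = y ∨ p.1.shift p.2.1.1 = y)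
    (hqB : ∀ e : Edge d L, e.1 = y ∨ e.1.shift e.2 = y → e ≠ (p.1, p.2.1.1) →
      ∀ (U : GaugeConfig d L G) (v : G), q (update U e v) = q U) :
    (∫ U, ∫ v, ∫ v', min
        (Real.exp (-β * wilsonAction ρ (update U (p.1, p.2.1.1) v)) * q (update U (p.1, p.2.1.1) v'))
        (Real.exp (-β * wilsonAction ρ (update U (p.1, p.2.1.1) v')) * q (update U (p.1, p.2.1.1) v))
        ∂(haarProbability G) ∂(haarProbability G) ∂Measure.pi (fun _ : Edge d L => haarProbability G)) /
        ∫ W, Real.exp (-β * wilsonAction ρ W) ∂Measure.pi (fun _ : Edge d L => haarProbability G) ≤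
      1 - 1 / (2 * N * ∫ W, Real.exp (-β * wilsonAction ρ W) ∂Measure.pi (fun _ : Edge d L => haarProbability G)) *
        ∫ U, (ρ (plaquetteHolonomy U p.1 p.2.1.1 p.2.1.2)).trace.re * Real.exp (-β * wilsonAction ρ U)
          ∂Measure.pi (fun _ : Edge d L => haarProbability G) := by
  classical
  set μ := haarProbability G with hμ
  set π := Measure.pi (fun _ : Edge d L => μ) with hπ
  set F : GaugeConfig d L G → ℝ := fun U => Real.exp (-β * wilsonAction ρ U) with hF
  set a : Edge d L := (p.1, p.2.1.1) with ha
  set sH : Finset (Edge d L) := Finset.univ \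
      {(p.1, p.2.1.1), (p.1.shift p.2.1.1, p.2.1.2), (p.1.shift p.2.1.2, p.2.1.1), (p.1, p.2.1.2)} with hsH
  set Z : ℝ := ∫ W, F W ∂π with hZ
  set I : ℝ := ∫ U, |F U - coordAvg μ {a} F U * q U| ∂π with hI
  set X : ℝ := ∫ U, (ρ (plaquetteHolonomy U p.1 p.2.1.1 p.2.1.2)).trace.re * F U ∂π with hX
  obtain ⟨hFm, B, hFlo, hFhi⟩ := wilsonWeight_props (d := d) (L := L) ρ hρ β
  have hF0 : ∀ U : GaugeConfig d L G, 0 ≤ F U := fun U => (Real.exp_pos _).le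
  have hFabs : ∀ U : GaugeConfig d L G, |F U| ≤ Real.exp (|β| * B) := fun U => by
    rw [abs_of_pos (Real.exp_pos _)]; exact hFhi U
  have hZpos : 0 < Z :=
    integral_exp_pos (Literature.Probability.LatticeModels.integrable_of_continuous_compactSpace _
      (Real.continuous_exp.comp (continuous_const.mul (continuous_wilsonAction ρ hρ))))
  have hqabs : ∀ U, |q U| ≤ Cq := fun U => by rw [abs_of_nonneg (hq0 U)]; exact hqb U
  -- (1) the site ceiling and its total-variation form
  have h1 := siteMeanAccept_le_overlap μ (a := a) hFm hF0 hFhi hZpos hqm hq0 hqb hq1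
  have h2 := siteOverlap_eq_one_sub_half_integral_abs μ (a := a) hFm hF0 hFhi hZpos hqm hq0 hqb hq1
  rw [h2] at h1
  -- (2) vertex-blind is no better than flat: `∫|F − A_aF| ≤ ∫|F − q A_aF| = I`
  haveI : Fact (1 < L) := ⟨hL⟩
  have hloop : a.1 ≠ a.1.shift a.2 := fun h => (site_shift_ne hL p.1 p.2.1.1) (by rw [ha] at h; exact h.symm)
  have hy' : a.1 = y ∨ a.1.shift a.2 = y := by simpa [ha] using hy
  have hV := integral_abs_sub_le_of_vertexBlind (∅ : Finset (Edge d L)) {a}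
    (isGaugeInvariant_wilsonWeightFun ρ β) hFm ⟨_, hFabs⟩ hy' hloop hqm ⟨Cq, hqabs⟩
    (by simpa [ha] using hqB) (by simpa [ha] using hq1)
  have hV' : ∫ U, |coordAvg μ (∅ : Finset (Edge d L)) F U - coordAvg μ {a} F U| ∂π ≤ I := by
    refine hV.trans (le_of_eq (integral_congr_ae (ae_of_all _ fun U => ?_)))
    show |coordAvg μ (∅ : Finset (Edge d L)) F U - q U * coordAvg μ {a} F U| = |F U - coordAvg μ {a} F U * q U|
    rw [coordAvg_empty, mul_comm]
  -- (3) less context, closer to flat: from the empty integrated set to the links off the plaquette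
  have hasH : a ∉ sH := by simp [hsH, ha]
  have hmono := integral_abs_condGap_mono μ (Finset.empty_subset sH) hasH hFm hFabs
  rw [Finset.insert_empty] at hmono
  -- (4) the engine
  have hH := wilson_plaquetteMarginal_tv_lower_bound (d := d) (L := L) ρ hρ hL hω hne β p
  have hXle : X ≤ (N : ℝ) * I := hH.trans (mul_le_mul_of_nonneg_left (hmono.trans hV') (Nat.cast_nonneg N))
  have hI0 : 0 ≤ I := integral_nonneg fun U => abs_nonneg _
  rcases Nat.eq_zero_or_pos N with hN0 | hNpos
  · subst hN0
    have : (1 : ℝ) / (2 * ((0 : ℕ) : ℝ) * Z) * X = 0 := by simp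
    rw [this, sub_zero]
    have h3 : 0 ≤ I / (2 * Z) := div_nonneg hI0 (by positivity)
    linarith
  · have hNr : (0 : ℝ) < N := by exact_mod_cast hNpos
    have hkey : 1 / (2 * N * Z) * X ≤ I / (2 * Z) := by
      calc 1 / (2 * N * Z) * X ≤ 1 / (2 * N * Z) * ((N : ℝ) * I) :=
            mul_le_mul_of_nonneg_left hXle (by positivity)
        _ = I / (2 * Z) := by field_simp
    linarith

set_option maxHeartbeats 400000 in
/-- **THE VOLUME-UNIFORM NUMBER FOR LEARNED HEAT BATHS**: unitary `ρ`, `N ≥ 1`, `d ≥ 2`, `β > 0`, every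
`r > 0`: `ā_a ≤ 1 − ½(1 − 8r²/N + 2 log φ_ρ(r)/((d−1)Nβ))`. [ours] -/
theorem wilson_siteMeanAccept_le_linkBall (hd : 2 ≤ d) (hN : 1 ≤ N) (hρ : Continuous ρ)
    (hρU : ∀ g, ρ g ∈ Matrix.unitaryGroup (Fin N) ℂ) (hL : 2 ≤ L)
    {z : G} {ω : ℂ} (hω : ρ z = ω • (1 : Matrix (Fin N) (Fin N) ℂ)) (hne : ω ≠ 1)
    {β : ℝ} (hβ : 0 < β) {r : ℝ} (hr : 0 < r) (p : Plaquette d L)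
    {q : GaugeConfig d L G → ℝ} (hqm : Measurable q) (hq0 : ∀ U, 0 ≤ q U) {Cq : ℝ} (hqb : ∀ U, q U ≤ Cq)
    (hq1 : ∀ U, ∫ v, q (update U (p.1, p.2.1.1) v) ∂(haarProbability G) = 1)
    {y : Site d L} (hy : p.1 = y ∨ p.1.shift p.2.1.1 = y)
    (hqB : ∀ e : Edge d L, e.1 = y ∨ e.1.shift e.2 = y → e ≠ (p.1, p.2.1.1) →
      ∀ (U : GaugeConfig d L G) (v : G), q (update U e v) = q U) :
    (∫ U, ∫ v, ∫ v', min
        (Real.exp (-β * wilsonAction ρ (update U (p.1, p.2.1.1) v)) * q (update U (p.1, p.2.1.1) v'))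
        (Real.exp (-β * wilsonAction ρ (update U (p.1, p.2.1.1) v')) * q (update U (p.1, p.2.1.1) v))
        ∂(haarProbability G) ∂(haarProbability G) ∂Measure.pi (fun _ : Edge d L => haarProbability G)) /
        ∫ W, Real.exp (-β * wilsonAction ρ W) ∂Measure.pi (fun _ : Edge d L => haarProbability G) ≤
      1 - (1 / 2) * (1 - 8 * r ^ 2 / N +
        2 * Real.log ((haarProbability G).real {g : G | ‖ρ g - 1‖ ≤ r}) / (((d : ℝ) - 1) * N * β)) := by
  set π := Measure.pi (fun _ : Edge d L => haarProbability G) with hπ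
  set Z : ℝ := ∫ W, Real.exp (-β * wilsonAction ρ W) ∂π with hZ
  set X : ℝ := ∫ U, (ρ (plaquetteHolonomy U p.1 p.2.1.1 p.2.1.2)).trace.re *
    Real.exp (-β * wilsonAction ρ U) ∂π with hX
  have hZpos : 0 < Z :=
    integral_exp_pos (Literature.Probability.LatticeModels.integrable_of_continuous_compactSpace _
      (Real.continuous_exp.comp (continuous_const.mul (continuous_wilsonAction ρ hρ))))
  have hNr : (0 : ℝ) < N := by exact_mod_cast hN
  have hceil := wilson_siteMeanAccept_le_of_vertexBlind (d := d) (L := L) ρ hρ hL hω hne β p hqm hq0 hqb hq1 hy hqB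
  have hfloor := wilsonExpectation_plaquette_ge_linkBall (d := d) (L := L) ρ hd hN hρ hρU hβ hr p.1
    (ne_of_lt p.2.2)
  rw [wilsonExpectation_eq_integral_div ρ hρ] at hfloor
  have hnum : ∫ U, (N : ℝ)⁻¹ * (ρ (plaquetteHolonomy U p.1 p.2.1.1 p.2.1.2)).trace.re *
        Real.exp (-β * wilsonAction ρ U) ∂π = (N : ℝ)⁻¹ * X := by
    rw [hX, ← integral_const_mul]
    refine integral_congr_ae (ae_of_all _ fun U => ?_)
    ring
  rw [hnum] at hfloor
  have hkey : (1 / 2 : ℝ) * (1 - 8 * r ^ 2 / N +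
        2 * Real.log ((haarProbability G).real {g : G | ‖ρ g - 1‖ ≤ r}) / (((d : ℝ) - 1) * N * β)) ≤
      1 / (2 * N * Z) * X := by
    have e : 1 / (2 * N * Z) * X = (1 / 2) * ((N : ℝ)⁻¹ * X / Z) := by field_simp
    rw [e]
    exact mul_le_mul_of_nonneg_left hfloor (by norm_num)
  linarith

/-! ## Instances: `SU(n)` and `U(1)` -/

section Instances

variable {d L n : ℕ} [NeZero L]

set_option maxHeartbeats 400000 in
/-- **LEARNED HEAT BATH, `SU(n)` (`n ≥ 2`, `d ≥ 2`, `L ≥ 2`, `β > 0`, `r > 0`):** a Metropolised single-link update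
of `SU(n)` Wilson theory whose proposal ignores the links at one endpoint of the link accepts at most
`1 − ½(1 − 8r²/n + 2 log Haar{‖g − 1‖ ≤ r}/((d−1)nβ))`. [ours] -/
theorem sun_siteMeanAccept_le_linkBall (hn : 2 ≤ n) (hd : 2 ≤ d) (hL : 2 ≤ L) {β : ℝ} (hβ : 0 < β)
    {r : ℝ} (hr : 0 < r) (p : Plaquette d L)
    {q : GaugeConfig d L (Matrix.specialUnitaryGroup (Fin n) ℂ) → ℝ} (hqm : Measurable q)
    (hq0 : ∀ U, 0 ≤ q U) {Cq : ℝ} (hqb : ∀ U, q U ≤ Cq)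
    (hq1 : ∀ U, ∫ v, q (update U (p.1, p.2.1.1) v) ∂(haarProbability (Matrix.specialUnitaryGroup (Fin n) ℂ)) = 1)
    {y : Site d L} (hy : p.1 = y ∨ p.1.shift p.2.1.1 = y)
    (hqB : ∀ e : Edge d L, e.1 = y ∨ e.1.shift e.2 = y → e ≠ (p.1, p.2.1.1) →
      ∀ (U : GaugeConfig d L (Matrix.specialUnitaryGroup (Fin n) ℂ))
        (v : Matrix.specialUnitaryGroup (Fin n) ℂ), q (update U e v) = q U) :
    (∫ U, ∫ v, ∫ v', min
        (Real.exp (-β * wilsonAction (StrongCoupling.defRep n) (update U (p.1, p.2.1.1) v)) *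
          q (update U (p.1, p.2.1.1) v'))
        (Real.exp (-β * wilsonAction (StrongCoupling.defRep n) (update U (p.1, p.2.1.1) v')) *
          q (update U (p.1, p.2.1.1) v))
        ∂(haarProbability (Matrix.specialUnitaryGroup (Fin n) ℂ))
        ∂(haarProbability (Matrix.specialUnitaryGroup (Fin n) ℂ))
        ∂Measure.pi (fun _ : Edge d L => haarProbability (Matrix.specialUnitaryGroup (Fin n) ℂ))) /
        ∫ W, Real.exp (-β * wilsonAction (StrongCoupling.defRep n) W)
          ∂Measure.pi (fun _ : Edge d L => haarProbability (Matrix.specialUnitaryGroup (Fin n) ℂ)) ≤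
      1 - (1 / 2) * (1 - 8 * r ^ 2 / n +
        2 * Real.log ((haarProbability (Matrix.specialUnitaryGroup (Fin n) ℂ)).real
          {g : Matrix.specialUnitaryGroup (Fin n) ℂ | ‖(g : Matrix (Fin n) (Fin n) ℂ) - 1‖ ≤ r}) /
          (((d : ℝ) - 1) * n * β)) := by
  haveI : SecondCountableTopology (Matrix (Fin n) (Fin n) ℂ) :=
    inferInstanceAs (SecondCountableTopology (Fin n → Fin n → ℂ))
  haveI : SecondCountableTopology (Matrix.specialUnitaryGroup (Fin n) ℂ) :=
    Topology.IsEmbedding.subtypeVal.secondCountableTopology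
  have hn0 : n ≠ 0 := by omega
  set ω : ℂ := Complex.exp (2 * Real.pi * Complex.I / n) with hωdef
  have hprim : IsPrimitiveRoot ω n := Complex.isPrimitiveRoot_exp n hn0
  have hωn : ω ^ n = 1 := hprim.pow_eq_one
  have hne : ω ≠ 1 := hprim.ne_one (by omega)
  have hω : StrongCoupling.defRep n (Literature.Barriers.QuantumFields.scalarCenter n ω hωn (by omega)) =
      ω • (1 : Matrix (Fin n) (Fin n) ℂ) := rfl
  exact wilson_siteMeanAccept_le_linkBall (StrongCoupling.defRep n) hd (by omega) continuous_subtype_val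
    (fun g => Matrix.specialUnitaryGroup_le_unitaryGroup g.2) hL hω hne hβ hr p hqm hq0 hqb hq1 hy hqB

set_option maxHeartbeats 400000 in
/-- **LEARNED HEAT BATH, `U(1)` (`d ≥ 2`, `L ≥ 2`, `β > 0`, `r > 0`; centre `−1`).** [ours] -/
theorem u1_siteMeanAccept_le_linkBall (hd : 2 ≤ d) (hL : 2 ≤ L) {β : ℝ} (hβ : 0 < β)
    {r : ℝ} (hr : 0 < r) (p : Plaquette d L)
    {q : GaugeConfig d L Circle → ℝ} (hqm : Measurable q) (hq0 : ∀ U, 0 ≤ q U) {Cq : ℝ} (hqb : ∀ U, q U ≤ Cq)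
    (hq1 : ∀ U, ∫ v, q (update U (p.1, p.2.1.1) v) ∂(haarProbability Circle) = 1)
    {y : Site d L} (hy : p.1 = y ∨ p.1.shift p.2.1.1 = y)
    (hqB : ∀ e : Edge d L, e.1 = y ∨ e.1.shift e.2 = y → e ≠ (p.1, p.2.1.1) →
      ∀ (U : GaugeConfig d L Circle) (v : Circle), q (update U e v) = q U) :
    (∫ U, ∫ v, ∫ v', min
        (Real.exp (-β * wilsonAction u1Rep (update U (p.1, p.2.1.1) v)) * q (update U (p.1, p.2.1.1) v'))
        (Real.exp (-β * wilsonAction u1Rep (update U (p.1, p.2.1.1) v')) * q (update U (p.1, p.2.1.1) v))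
        ∂(haarProbability Circle) ∂(haarProbability Circle) ∂Measure.pi (fun _ : Edge d L => haarProbability Circle)) /
        ∫ W, Real.exp (-β * wilsonAction u1Rep W) ∂Measure.pi (fun _ : Edge d L => haarProbability Circle) ≤
      1 - (1 / 2) * (1 - 8 * r ^ 2 +
        2 * Real.log ((haarProbability Circle).real {g : Circle | ‖u1Rep g - 1‖ ≤ r}) / (((d : ℝ) - 1) * β)) := by
  have h := wilson_siteMeanAccept_le_linkBall (d := d) (L := L) u1Rep hd le_rfl continuous_u1Rep
    u1Rep_mem_unitaryGroup hL u1Rep_neg_one (by norm_num) hβ hr p hqm hq0 hqb hq1 hy hqB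
  have e : (1 : ℝ) - 1 / 2 * (1 - 8 * r ^ 2 / ((1 : ℕ) : ℝ) +
      2 * Real.log ((haarProbability Circle).real {g : Circle | ‖u1Rep g - 1‖ ≤ r}) / (((d : ℝ) - 1) * ((1 : ℕ) : ℝ) * β)) =
      1 - 1 / 2 * (1 - 8 * r ^ 2 +
        2 * Real.log ((haarProbability Circle).real {g : Circle | ‖u1Rep g - 1‖ ≤ r}) / (((d : ℝ) - 1) * β)) := by
    norm_num
  exact h.trans (le_of_eq e)

end Instances

end Summit.Ventures.LatticeQCDFlow.Theory2.Autoregressive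

end
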